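import Mathlib
import Summits.KontsevichZagierPeriods.KontsevichZagierPeriods.Theorems.MzvKernelInKZTwoPosetsInteriorLandenAux1

/-!
# `LegendreCubicForm` (stmt-KontsevichZagierPeriods-3521), line `Sketch` (hat-box chart): stub `stub_hatBoxJacobian`

Pure real analysis of the hat-box substitution (move M1 of the line; lead's file). On the open period
rectangle `R = (e₁,e₂) × (e₂,e₃)` of the cubic `P(x) = (x−e₁)(x−e₂)(x−e₃)` put

* `u(λ,μ) = √((e₃−e₁)(e₂−λ)(μ−e₂)/((e₃−e₂)(λ−e₁)(μ−e₁)))` (tangent of the azimuth of the point of `S²`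
  with sphero-conal coordinates `(λ,μ)`), `z(λ,μ) = √((e₃−λ)(e₃−μ)/((e₃−e₁)(e₃−e₂)))` (its height),
  `Λ = (u,z)`.

We prove that `Λ` is differentiable at every point of `R`, compute the four partials
`u_λ = −u(e₂−e₁)/(2(λ−e₁)(e₂−λ))`, `u_μ = u(e₂−e₁)/(2(μ−e₁)(μ−e₂))`, `z_λ = −z/(2(e₃−λ))`,
`z_μ = −z/(2(e₃−μ))` as derivatives along coordinate lines, hence `det DΛ = u_λ z_μ − u_μ z_λ`, and the
PULL-BACK IDENTITY `(μ−λ)/√(|P(λ)||P(μ)|) = (4/(1+u²))·|det DΛ|` (Archimedes' hat-box: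
`g dλ dμ = 4 dA_{S²} = 4 dθ dz`). Its polynomial heart is `x₁² + x₂² = 1 − x₃²` cleared of denominators,
`(e₂−e₁)((e₃−e₁)(e₃−e₂) − (e₃−λ)(e₃−μ)) = (e₃−e₂)(λ−e₁)(μ−e₁) + (e₂−λ)(μ−e₂)(e₃−e₁)`, together with
`(λ−e₁)(e₂−λ)(e₃−μ) + (μ−e₁)(μ−e₂)(e₃−λ) = (μ−λ)((e₃−e₁)(e₃−e₂) − (e₃−λ)(e₃−μ))`.

No definitions or notations are introduced (all objects are written out). References: Kontsevich–Zagier 2001 §1.2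
rule (2); Bolsinov–Fomenko 2004 §13.3.2 (sphero-conical coordinates); Archimedes, *On the Sphere and
Cylinder* I (hat-box theorem).
-/

noncomputable section

namespace Summit.KontsevichZagierPeriods.UnfoldedStokes.LegendreCubicFormLine

open Set
open Summit.KontsevichZagierPeriods.MzvKernelInKZ.TwoPosets.Landen

/-! ## A `2 × 2` determinant -/

/-- `det (A, B) = A e₀ · B e₁ − A e₁ · B e₀` for two linear forms on `ℝ²` stacked into a map `ℝ² → ℝ²`.
[folklore] -/
theorem det_pi_fin_two (A B : (Fin 2 → ℝ) →L[ℝ] ℝ) :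
    (ContinuousLinearMap.pi ![A, B] : (Fin 2 → ℝ) →L[ℝ] (Fin 2 → ℝ)).det =
      A (Pi.single 0 1) * B (Pi.single 1 1) - A (Pi.single 1 1) * B (Pi.single 0 1) := by
  show LinearMap.det ((ContinuousLinearMap.pi ![A, B] :
    (Fin 2 → ℝ) →L[ℝ] (Fin 2 → ℝ)) : (Fin 2 → ℝ) →ₗ[ℝ] (Fin 2 → ℝ)) = _
  rw [← LinearMap.det_toMatrix', Matrix.det_fin_two]
  simp [LinearMap.toMatrix'_apply]

/-! ## The four partial derivatives along coordinate lines -/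

section Partials

variable {e₁ e₂ e₃ : ℚ} {x : Fin 2 → ℝ}

/-- `∂u/∂λ = −u(e₂−e₁)/(2(λ−e₁)(e₂−λ))` (derivative along the first coordinate line). [folklore] -/
theorem hasDerivAt_u_line0 (h1 : (e₁ : ℝ) < x 0) (h2 : x 0 < (e₂ : ℝ)) (h3 : (e₂ : ℝ) < x 1)
    (h4 : x 1 < (e₃ : ℝ)) :
    HasDerivAt (fun t : ℝ => Real.sqrt (((e₃ : ℝ) - (e₁ : ℝ)) * ((e₂ : ℝ) - t) * (x 1 - (e₂ : ℝ)) /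
        (((e₃ : ℝ) - (e₂ : ℝ)) * (t - (e₁ : ℝ)) * (x 1 - (e₁ : ℝ)))))
      (-Real.sqrt (((e₃ : ℝ) - (e₁ : ℝ)) * ((e₂ : ℝ) - x 0) * (x 1 - (e₂ : ℝ)) / (((e₃ : ℝ) - (e₂ : ℝ)) * (x 0 - (e₁ : ℝ)) * (x 1 - (e₁ : ℝ)))) * ((e₂ : ℝ) - (e₁ : ℝ)) / (2 * (x 0 - (e₁ : ℝ)) * ((e₂ : ℝ) - x 0)))
      (x 0) := by
  have ha : 0 < x 0 - (e₁ : ℝ) := sub_pos.2 h1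
  have hb : 0 < (e₂ : ℝ) - x 0 := sub_pos.2 h2
  have hc : 0 < x 1 - (e₂ : ℝ) := sub_pos.2 h3
  have hd : 0 < x 1 - (e₁ : ℝ) := by linarith
  have hD : 0 < (e₃ : ℝ) - (e₁ : ℝ) := by linarith
  have hD₂ : 0 < (e₃ : ℝ) - (e₂ : ℝ) := by linarith
  have hF : 0 < (((e₃ : ℝ) - (e₁ : ℝ)) * ((e₂ : ℝ) - x 0) * (x 1 - (e₂ : ℝ)) / (((e₃ : ℝ) - (e₂ : ℝ)) * (x 0 - (e₁ : ℝ)) * (x 1 - (e₁ : ℝ)))) := by positivity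
  have hN : HasDerivAt (fun t : ℝ => ((e₃ : ℝ) - (e₁ : ℝ)) * ((e₂ : ℝ) - t) * (x 1 - (e₂ : ℝ)))
      (((e₃ : ℝ) - (e₁ : ℝ)) * (-1) * (x 1 - (e₂ : ℝ))) (x 0) :=
    (((hasDerivAt_id (x 0)).const_sub (e₂ : ℝ)).const_mul _).mul_const _
  have hDd : HasDerivAt (fun t : ℝ => ((e₃ : ℝ) - (e₂ : ℝ)) * (t - (e₁ : ℝ)) * (x 1 - (e₁ : ℝ)))
      (((e₃ : ℝ) - (e₂ : ℝ)) * 1 * (x 1 - (e₁ : ℝ))) (x 0) :=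
    (((hasDerivAt_id (x 0)).sub_const (e₁ : ℝ)).const_mul _).mul_const _
  have hD0 : ((e₃ : ℝ) - (e₂ : ℝ)) * (x 0 - (e₁ : ℝ)) * (x 1 - (e₁ : ℝ)) ≠ 0 := by positivity
  refine ((hN.div hDd hD0).sqrt hF.ne').congr_deriv ?_
  simp only [Pi.div_apply]
  set S := Real.sqrt (((e₃ : ℝ) - (e₁ : ℝ)) * ((e₂ : ℝ) - x 0) * (x 1 - (e₂ : ℝ)) / (((e₃ : ℝ) - (e₂ : ℝ)) * (x 0 - (e₁ : ℝ)) * (x 1 - (e₁ : ℝ)))) with hS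
  have hS2 : S ^ 2 = (((e₃ : ℝ) - (e₁ : ℝ)) * ((e₂ : ℝ) - x 0) * (x 1 - (e₂ : ℝ)) / (((e₃ : ℝ) - (e₂ : ℝ)) * (x 0 - (e₁ : ℝ)) * (x 1 - (e₁ : ℝ)))) := Real.sq_sqrt hF.le
  have hS0 : 0 < S := Real.sqrt_pos.2 hF
  rw [div_eq_div_iff (by positivity) (by positivity)]
  have key : -S * ((e₂ : ℝ) - (e₁ : ℝ)) * (2 * S) = -(2 * ((e₂ : ℝ) - (e₁ : ℝ))) * S ^ 2 := by ring
  rw [key, hS2]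
  field_simp
  ring

/-- `∂u/∂μ = u(e₂−e₁)/(2(μ−e₁)(μ−e₂))` (derivative along the second coordinate line). [folklore] -/
theorem hasDerivAt_u_line1 (h1 : (e₁ : ℝ) < x 0) (h2 : x 0 < (e₂ : ℝ)) (h3 : (e₂ : ℝ) < x 1)
    (h4 : x 1 < (e₃ : ℝ)) :
    HasDerivAt (fun t : ℝ => Real.sqrt (((e₃ : ℝ) - (e₁ : ℝ)) * ((e₂ : ℝ) - x 0) * (t - (e₂ : ℝ)) /
        (((e₃ : ℝ) - (e₂ : ℝ)) * (x 0 - (e₁ : ℝ)) * (t - (e₁ : ℝ)))))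
      (Real.sqrt (((e₃ : ℝ) - (e₁ : ℝ)) * ((e₂ : ℝ) - x 0) * (x 1 - (e₂ : ℝ)) / (((e₃ : ℝ) - (e₂ : ℝ)) * (x 0 - (e₁ : ℝ)) * (x 1 - (e₁ : ℝ)))) * ((e₂ : ℝ) - (e₁ : ℝ)) / (2 * (x 1 - (e₁ : ℝ)) * (x 1 - (e₂ : ℝ))))
      (x 1) := by
  have ha : 0 < x 0 - (e₁ : ℝ) := sub_pos.2 h1
  have hb : 0 < (e₂ : ℝ) - x 0 := sub_pos.2 h2
  have hc : 0 < x 1 - (e₂ : ℝ) := sub_pos.2 h3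
  have hd : 0 < x 1 - (e₁ : ℝ) := by linarith
  have hD : 0 < (e₃ : ℝ) - (e₁ : ℝ) := by linarith
  have hD₂ : 0 < (e₃ : ℝ) - (e₂ : ℝ) := by linarith
  have hF : 0 < (((e₃ : ℝ) - (e₁ : ℝ)) * ((e₂ : ℝ) - x 0) * (x 1 - (e₂ : ℝ)) / (((e₃ : ℝ) - (e₂ : ℝ)) * (x 0 - (e₁ : ℝ)) * (x 1 - (e₁ : ℝ)))) := by positivity
  have hN : HasDerivAt (fun t : ℝ => ((e₃ : ℝ) - (e₁ : ℝ)) * ((e₂ : ℝ) - x 0) * (t - (e₂ : ℝ)))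
      (((e₃ : ℝ) - (e₁ : ℝ)) * ((e₂ : ℝ) - x 0) * 1) (x 1) :=
    ((hasDerivAt_id (x 1)).sub_const (e₂ : ℝ)).const_mul _
  have hDd : HasDerivAt (fun t : ℝ => ((e₃ : ℝ) - (e₂ : ℝ)) * (x 0 - (e₁ : ℝ)) * (t - (e₁ : ℝ)))
      (((e₃ : ℝ) - (e₂ : ℝ)) * (x 0 - (e₁ : ℝ)) * 1) (x 1) :=
    ((hasDerivAt_id (x 1)).sub_const (e₁ : ℝ)).const_mul _
  have hD0 : ((e₃ : ℝ) - (e₂ : ℝ)) * (x 0 - (e₁ : ℝ)) * (x 1 - (e₁ : ℝ)) ≠ 0 := by positivity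
  refine ((hN.div hDd hD0).sqrt hF.ne').congr_deriv ?_
  simp only [Pi.div_apply]
  set S := Real.sqrt (((e₃ : ℝ) - (e₁ : ℝ)) * ((e₂ : ℝ) - x 0) * (x 1 - (e₂ : ℝ)) / (((e₃ : ℝ) - (e₂ : ℝ)) * (x 0 - (e₁ : ℝ)) * (x 1 - (e₁ : ℝ)))) with hS
  have hS2 : S ^ 2 = (((e₃ : ℝ) - (e₁ : ℝ)) * ((e₂ : ℝ) - x 0) * (x 1 - (e₂ : ℝ)) / (((e₃ : ℝ) - (e₂ : ℝ)) * (x 0 - (e₁ : ℝ)) * (x 1 - (e₁ : ℝ)))) := Real.sq_sqrt hF.le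
  have hS0 : 0 < S := Real.sqrt_pos.2 hF
  rw [div_eq_div_iff (by positivity) (by positivity)]
  have key : S * ((e₂ : ℝ) - (e₁ : ℝ)) * (2 * S) = (2 * ((e₂ : ℝ) - (e₁ : ℝ))) * S ^ 2 := by ring
  rw [key, hS2]
  field_simp
  ring

/-- `∂z/∂λ = −z/(2(e₃−λ))` (derivative along the first coordinate line). [folklore] -/
theorem hasDerivAt_z_line0 (h1 : (e₁ : ℝ) < x 0) (h2 : x 0 < (e₂ : ℝ)) (h3 : (e₂ : ℝ) < x 1)
    (h4 : x 1 < (e₃ : ℝ)) :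
    HasDerivAt (fun t : ℝ => Real.sqrt (((e₃ : ℝ) - t) * ((e₃ : ℝ) - x 1) /
        (((e₃ : ℝ) - (e₁ : ℝ)) * ((e₃ : ℝ) - (e₂ : ℝ)))))
      (-Real.sqrt (((e₃ : ℝ) - x 0) * ((e₃ : ℝ) - x 1) / (((e₃ : ℝ) - (e₁ : ℝ)) * ((e₃ : ℝ) - (e₂ : ℝ)))) / (2 * ((e₃ : ℝ) - x 0))) (x 0) := by
  have hp : 0 < (e₃ : ℝ) - x 0 := by linarith
  have hq : 0 < (e₃ : ℝ) - x 1 := sub_pos.2 h4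
  have hD : 0 < (e₃ : ℝ) - (e₁ : ℝ) := by linarith
  have hD₂ : 0 < (e₃ : ℝ) - (e₂ : ℝ) := by linarith
  have hF : 0 < (((e₃ : ℝ) - x 0) * ((e₃ : ℝ) - x 1) / (((e₃ : ℝ) - (e₁ : ℝ)) * ((e₃ : ℝ) - (e₂ : ℝ)))) := by positivity
  have hN : HasDerivAt (fun t : ℝ => ((e₃ : ℝ) - t) * ((e₃ : ℝ) - x 1) /
        (((e₃ : ℝ) - (e₁ : ℝ)) * ((e₃ : ℝ) - (e₂ : ℝ))))
      ((-1) * ((e₃ : ℝ) - x 1) / (((e₃ : ℝ) - (e₁ : ℝ)) * ((e₃ : ℝ) - (e₂ : ℝ)))) (x 0) :=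
    (((hasDerivAt_id (x 0)).const_sub (e₃ : ℝ)).mul_const _).div_const _
  refine (hN.sqrt hF.ne').congr_deriv ?_
  set S := Real.sqrt (((e₃ : ℝ) - x 0) * ((e₃ : ℝ) - x 1) / (((e₃ : ℝ) - (e₁ : ℝ)) * ((e₃ : ℝ) - (e₂ : ℝ)))) with hS
  have hS2 : S ^ 2 = (((e₃ : ℝ) - x 0) * ((e₃ : ℝ) - x 1) / (((e₃ : ℝ) - (e₁ : ℝ)) * ((e₃ : ℝ) - (e₂ : ℝ)))) := Real.sq_sqrt hF.le
  have hS0 : 0 < S := Real.sqrt_pos.2 hF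
  rw [div_eq_div_iff (by positivity) (by positivity)]
  have key : -S * (2 * S) = -2 * S ^ 2 := by ring
  rw [key, hS2]
  field_simp

/-- `∂z/∂μ = −z/(2(e₃−μ))` (derivative along the second coordinate line). [folklore] -/
theorem hasDerivAt_z_line1 (h1 : (e₁ : ℝ) < x 0) (h2 : x 0 < (e₂ : ℝ)) (h3 : (e₂ : ℝ) < x 1)
    (h4 : x 1 < (e₃ : ℝ)) :
    HasDerivAt (fun t : ℝ => Real.sqrt (((e₃ : ℝ) - x 0) * ((e₃ : ℝ) - t) /
        (((e₃ : ℝ) - (e₁ : ℝ)) * ((e₃ : ℝ) - (e₂ : ℝ)))))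
      (-Real.sqrt (((e₃ : ℝ) - x 0) * ((e₃ : ℝ) - x 1) / (((e₃ : ℝ) - (e₁ : ℝ)) * ((e₃ : ℝ) - (e₂ : ℝ)))) / (2 * ((e₃ : ℝ) - x 1))) (x 1) := by
  have hp : 0 < (e₃ : ℝ) - x 0 := by linarith
  have hq : 0 < (e₃ : ℝ) - x 1 := sub_pos.2 h4
  have hD : 0 < (e₃ : ℝ) - (e₁ : ℝ) := by linarith
  have hD₂ : 0 < (e₃ : ℝ) - (e₂ : ℝ) := by linarith
  have hF : 0 < (((e₃ : ℝ) - x 0) * ((e₃ : ℝ) - x 1) / (((e₃ : ℝ) - (e₁ : ℝ)) * ((e₃ : ℝ) - (e₂ : ℝ)))) := by positivity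
  have hN : HasDerivAt (fun t : ℝ => ((e₃ : ℝ) - x 0) * ((e₃ : ℝ) - t) /
        (((e₃ : ℝ) - (e₁ : ℝ)) * ((e₃ : ℝ) - (e₂ : ℝ))))
      (((e₃ : ℝ) - x 0) * (-1) / (((e₃ : ℝ) - (e₁ : ℝ)) * ((e₃ : ℝ) - (e₂ : ℝ)))) (x 1) :=
    (((hasDerivAt_id (x 1)).const_sub (e₃ : ℝ)).const_mul _).div_const _
  refine (hN.sqrt hF.ne').congr_deriv ?_
  set S := Real.sqrt (((e₃ : ℝ) - x 0) * ((e₃ : ℝ) - x 1) / (((e₃ : ℝ) - (e₁ : ℝ)) * ((e₃ : ℝ) - (e₂ : ℝ)))) with hS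
  have hS2 : S ^ 2 = (((e₃ : ℝ) - x 0) * ((e₃ : ℝ) - x 1) / (((e₃ : ℝ) - (e₁ : ℝ)) * ((e₃ : ℝ) - (e₂ : ℝ)))) := Real.sq_sqrt hF.le
  have hS0 : 0 < S := Real.sqrt_pos.2 hF
  rw [div_eq_div_iff (by positivity) (by positivity)]
  have key : -S * (2 * S) = -2 * S ^ 2 := by ring
  rw [key, hS2]
  field_simp

end Partials

/-! ## The registered stub -/

/-- **Stub `stub_hatBoxJacobian`** of line `Sketch` (hat-box chart) of crux stmt-KontsevichZagierPeriods-3521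
(`LegendreCubicForm`): on the open period rectangle the hat-box map `Λ = (u,z)` is differentiable, and the
crux integrand is its pull-back of the flat density: `(μ−λ)/√(|P(λ)||P(μ)|) = (4/(1+u²))·|det DΛ|`
(Archimedes' hat-box theorem in sphero-conal coordinates). [folklore] -/
theorem stub_hatBoxJacobian :
    ∀ (e₁ e₂ e₃ : ℚ), e₁ < e₂ → e₂ < e₃ → 
      ∀ x ∈ {x : Fin 2 → ℝ | (e₁ : ℝ) < x 0 ∧ x 0 < (e₂ : ℝ) ∧ (e₂ : ℝ) < x 1 ∧ x 1 < (e₃ : ℝ)},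
        ∃ L : (Fin 2 → ℝ) →L[ℝ] (Fin 2 → ℝ),
          HasFDerivAt (fun x : Fin 2 → ℝ => (![Real.sqrt (((e₃ : ℝ) - (e₁ : ℝ)) * ((e₂ : ℝ) - x 0) * (x 1 - (e₂ : ℝ)) / (((e₃ : ℝ) - (e₂ : ℝ)) * (x 0 - (e₁ : ℝ)) * (x 1 - (e₁ : ℝ)))), Real.sqrt (((e₃ : ℝ) - x 0) * ((e₃ : ℝ) - x 1) / (((e₃ : ℝ) - (e₁ : ℝ)) * ((e₃ : ℝ) - (e₂ : ℝ))))] : Fin 2 → ℝ)) L x ∧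
            (x 1 - x 0) / Real.sqrt (|(x 0 - (e₁ : ℝ)) * (x 0 - (e₂ : ℝ)) * (x 0 - (e₃ : ℝ))| * |(x 1 - (e₁ : ℝ)) * (x 1 - (e₂ : ℝ)) * (x 1 - (e₃ : ℝ))|) =
              4 / (1 + (Real.sqrt (((e₃ : ℝ) - (e₁ : ℝ)) * ((e₂ : ℝ) - x 0) * (x 1 - (e₂ : ℝ)) / (((e₃ : ℝ) - (e₂ : ℝ)) * (x 0 - (e₁ : ℝ)) * (x 1 - (e₁ : ℝ))))) ^ 2) * |L.det| := by
  intro e₁ e₂ e₃ h12 h23 x hx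
  obtain ⟨h1, h2, h3, h4⟩ := hx
  -- sign facts on the rectangle
  have ha : 0 < x 0 - (e₁ : ℝ) := sub_pos.2 h1
  have hb : 0 < (e₂ : ℝ) - x 0 := sub_pos.2 h2
  have hc : 0 < x 1 - (e₂ : ℝ) := sub_pos.2 h3
  have hd : 0 < x 1 - (e₁ : ℝ) := by linarith
  have hp : 0 < (e₃ : ℝ) - x 0 := by linarith
  have hq : 0 < (e₃ : ℝ) - x 1 := sub_pos.2 h4
  have hD : 0 < (e₃ : ℝ) - (e₁ : ℝ) := by linarith
  have hD₁ : 0 < (e₂ : ℝ) - (e₁ : ℝ) := by linarith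
  have hD₂ : 0 < (e₃ : ℝ) - (e₂ : ℝ) := by linarith
  have hml : 0 < x 1 - x 0 := by linarith
  have hFu : 0 < (((e₃ : ℝ) - (e₁ : ℝ)) * ((e₂ : ℝ) - x 0) * (x 1 - (e₂ : ℝ)) / (((e₃ : ℝ) - (e₂ : ℝ)) * (x 0 - (e₁ : ℝ)) * (x 1 - (e₁ : ℝ)))) := by positivity
  have hFz : 0 < (((e₃ : ℝ) - x 0) * ((e₃ : ℝ) - x 1) / (((e₃ : ℝ) - (e₁ : ℝ)) * ((e₃ : ℝ) - (e₂ : ℝ)))) := by positivity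
  -- differentiability of the two components
  have hden_u : ((e₃ : ℝ) - (e₂ : ℝ)) * (x 0 - (e₁ : ℝ)) * (x 1 - (e₁ : ℝ)) ≠ 0 := by positivity
  have hden_z : ((e₃ : ℝ) - (e₁ : ℝ)) * ((e₃ : ℝ) - (e₂ : ℝ)) ≠ 0 := by positivity
  have hUd : DifferentiableAt ℝ (fun y : Fin 2 → ℝ => Real.sqrt (((e₃ : ℝ) - (e₁ : ℝ)) * ((e₂ : ℝ) - y 0) * (y 1 - (e₂ : ℝ)) / (((e₃ : ℝ) - (e₂ : ℝ)) * (y 0 - (e₁ : ℝ)) * (y 1 - (e₁ : ℝ))))) x := by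
    have h : DifferentiableAt ℝ (fun y : Fin 2 → ℝ => (((e₃ : ℝ) - (e₁ : ℝ)) * ((e₂ : ℝ) - y 0) * (y 1 - (e₂ : ℝ)) / (((e₃ : ℝ) - (e₂ : ℝ)) * (y 0 - (e₁ : ℝ)) * (y 1 - (e₁ : ℝ))))) x := by
      fun_prop (disch := exact hden_u)
    exact h.sqrt hFu.ne'
  have hZd : DifferentiableAt ℝ (fun y : Fin 2 → ℝ => Real.sqrt (((e₃ : ℝ) - y 0) * ((e₃ : ℝ) - y 1) / (((e₃ : ℝ) - (e₁ : ℝ)) * ((e₃ : ℝ) - (e₂ : ℝ))))) x := by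
    have h : DifferentiableAt ℝ (fun y : Fin 2 → ℝ => (((e₃ : ℝ) - y 0) * ((e₃ : ℝ) - y 1) / (((e₃ : ℝ) - (e₁ : ℝ)) * ((e₃ : ℝ) - (e₂ : ℝ))))) x := by
      fun_prop (disch := exact hden_z)
    exact h.sqrt hFz.ne'
  set A : (Fin 2 → ℝ) →L[ℝ] ℝ := fderiv ℝ (fun y : Fin 2 → ℝ => Real.sqrt (((e₃ : ℝ) - (e₁ : ℝ)) * ((e₂ : ℝ) - y 0) * (y 1 - (e₂ : ℝ)) / (((e₃ : ℝ) - (e₂ : ℝ)) * (y 0 - (e₁ : ℝ)) * (y 1 - (e₁ : ℝ))))) x with hA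
  set B : (Fin 2 → ℝ) →L[ℝ] ℝ := fderiv ℝ (fun y : Fin 2 → ℝ => Real.sqrt (((e₃ : ℝ) - y 0) * ((e₃ : ℝ) - y 1) / (((e₃ : ℝ) - (e₁ : ℝ)) * ((e₃ : ℝ) - (e₂ : ℝ))))) x with hB
  refine ⟨ContinuousLinearMap.pi ![A, B], ?_, ?_⟩
  · -- the derivative of `Λ = (u, z)` is `(Du, Dz)`
    refine hasFDerivAt_pi'.2 (Fin.forall_fin_two.2 ⟨?_, ?_⟩)
    · simp only [Matrix.cons_val_zero, ContinuousLinearMap.proj_pi]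
      exact hUd.hasFDerivAt
    · simp only [Matrix.cons_val_one, ContinuousLinearMap.proj_pi]
      exact hZd.hasFDerivAt
  · -- the four partials, read off along coordinate lines
    have hu0 : A (Pi.single 0 1) =
        -Real.sqrt (((e₃ : ℝ) - (e₁ : ℝ)) * ((e₂ : ℝ) - x 0) * (x 1 - (e₂ : ℝ)) / (((e₃ : ℝ) - (e₂ : ℝ)) * (x 0 - (e₁ : ℝ)) * (x 1 - (e₁ : ℝ)))) * ((e₂ : ℝ) - (e₁ : ℝ)) / (2 * (x 0 - (e₁ : ℝ)) * ((e₂ : ℝ) - x 0)) := by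
      refine apply_single_eq_of_hasDerivAt 0 hUd.hasFDerivAt ?_
      refine (hasDerivAt_u_line0 h1 h2 h3 h4).congr_of_eventuallyEq ?_
      exact Filter.Eventually.of_forall fun t => by simp
    have hu1 : A (Pi.single 1 1) =
        Real.sqrt (((e₃ : ℝ) - (e₁ : ℝ)) * ((e₂ : ℝ) - x 0) * (x 1 - (e₂ : ℝ)) / (((e₃ : ℝ) - (e₂ : ℝ)) * (x 0 - (e₁ : ℝ)) * (x 1 - (e₁ : ℝ)))) * ((e₂ : ℝ) - (e₁ : ℝ)) / (2 * (x 1 - (e₁ : ℝ)) * (x 1 - (e₂ : ℝ))) := by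
      refine apply_single_eq_of_hasDerivAt 1 hUd.hasFDerivAt ?_
      refine (hasDerivAt_u_line1 h1 h2 h3 h4).congr_of_eventuallyEq ?_
      exact Filter.Eventually.of_forall fun t => by simp
    have hz0 : B (Pi.single 0 1) = -Real.sqrt (((e₃ : ℝ) - x 0) * ((e₃ : ℝ) - x 1) / (((e₃ : ℝ) - (e₁ : ℝ)) * ((e₃ : ℝ) - (e₂ : ℝ)))) / (2 * ((e₃ : ℝ) - x 0)) := by
      refine apply_single_eq_of_hasDerivAt 0 hZd.hasFDerivAt ?_
      refine (hasDerivAt_z_line0 h1 h2 h3 h4).congr_of_eventuallyEq ?_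
      exact Filter.Eventually.of_forall fun t => by simp
    have hz1 : B (Pi.single 1 1) = -Real.sqrt (((e₃ : ℝ) - x 0) * ((e₃ : ℝ) - x 1) / (((e₃ : ℝ) - (e₁ : ℝ)) * ((e₃ : ℝ) - (e₂ : ℝ)))) / (2 * ((e₃ : ℝ) - x 1)) := by
      refine apply_single_eq_of_hasDerivAt 1 hZd.hasFDerivAt ?_
      refine (hasDerivAt_z_line1 h1 h2 h3 h4).congr_of_eventuallyEq ?_
      exact Filter.Eventually.of_forall fun t => by simp
    rw [det_pi_fin_two, hu0, hu1, hz0, hz1]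
    -- the pull-back identity: pure algebra with the two square roots `U`, `Z`
    set U := Real.sqrt (((e₃ : ℝ) - (e₁ : ℝ)) * ((e₂ : ℝ) - x 0) * (x 1 - (e₂ : ℝ)) / (((e₃ : ℝ) - (e₂ : ℝ)) * (x 0 - (e₁ : ℝ)) * (x 1 - (e₁ : ℝ)))) with hU
    set Z := Real.sqrt (((e₃ : ℝ) - x 0) * ((e₃ : ℝ) - x 1) / (((e₃ : ℝ) - (e₁ : ℝ)) * ((e₃ : ℝ) - (e₂ : ℝ)))) with hZ
    have hU0 : 0 < U := Real.sqrt_pos.2 hFu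
    have hZ0 : 0 < Z := Real.sqrt_pos.2 hFz
    have hU2 : U ^ 2 = (((e₃ : ℝ) - (e₁ : ℝ)) * ((e₂ : ℝ) - x 0) * (x 1 - (e₂ : ℝ)) / (((e₃ : ℝ) - (e₂ : ℝ)) * (x 0 - (e₁ : ℝ)) * (x 1 - (e₁ : ℝ)))) := Real.sq_sqrt hFu.le
    have hZ2 : Z ^ 2 = (((e₃ : ℝ) - x 0) * ((e₃ : ℝ) - x 1) / (((e₃ : ℝ) - (e₁ : ℝ)) * ((e₃ : ℝ) - (e₂ : ℝ)))) := Real.sq_sqrt hFz.le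
    have habs1 : |(x 0 - (e₁ : ℝ)) * (x 0 - (e₂ : ℝ)) * (x 0 - (e₃ : ℝ))| =
        (x 0 - (e₁ : ℝ)) * ((e₂ : ℝ) - x 0) * ((e₃ : ℝ) - x 0) := by
      rw [show (x 0 - (e₁ : ℝ)) * (x 0 - (e₂ : ℝ)) * (x 0 - (e₃ : ℝ)) =
        (x 0 - (e₁ : ℝ)) * ((e₂ : ℝ) - x 0) * ((e₃ : ℝ) - x 0) by ring]
      exact abs_of_pos (by positivity)
    have habs2 : |(x 1 - (e₁ : ℝ)) * (x 1 - (e₂ : ℝ)) * (x 1 - (e₃ : ℝ))| =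
        (x 1 - (e₁ : ℝ)) * (x 1 - (e₂ : ℝ)) * ((e₃ : ℝ) - x 1) := by
      rw [show (x 1 - (e₁ : ℝ)) * (x 1 - (e₂ : ℝ)) * (x 1 - (e₃ : ℝ)) =
        -((x 1 - (e₁ : ℝ)) * (x 1 - (e₂ : ℝ)) * ((e₃ : ℝ) - x 1)) by ring, abs_neg]
      exact abs_of_pos (by positivity)
    rw [habs1, habs2]
    have hdet : -U * ((e₂ : ℝ) - (e₁ : ℝ)) / (2 * (x 0 - (e₁ : ℝ)) * ((e₂ : ℝ) - x 0)) *
          (-Z / (2 * ((e₃ : ℝ) - x 1))) -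
        U * ((e₂ : ℝ) - (e₁ : ℝ)) / (2 * (x 1 - (e₁ : ℝ)) * (x 1 - (e₂ : ℝ))) *
          (-Z / (2 * ((e₃ : ℝ) - x 0))) =
        U * Z * (((e₂ : ℝ) - (e₁ : ℝ)) / (4 * (x 0 - (e₁ : ℝ)) * ((e₂ : ℝ) - x 0) * ((e₃ : ℝ) - x 1)) +
          ((e₂ : ℝ) - (e₁ : ℝ)) / (4 * (x 1 - (e₁ : ℝ)) * (x 1 - (e₂ : ℝ)) * ((e₃ : ℝ) - x 0))) := by
      field_simp
      ring
    have hK : 0 < ((e₂ : ℝ) - (e₁ : ℝ)) / (4 * (x 0 - (e₁ : ℝ)) * ((e₂ : ℝ) - x 0) * ((e₃ : ℝ) - x 1)) +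
          ((e₂ : ℝ) - (e₁ : ℝ)) / (4 * (x 1 - (e₁ : ℝ)) * (x 1 - (e₂ : ℝ)) * ((e₃ : ℝ) - x 0)) := by
      positivity
    rw [hdet, abs_of_pos (by positivity)]
    -- compare squares of two positive reals
    have hL : 0 < (x 1 - x 0) / Real.sqrt ((x 0 - (e₁ : ℝ)) * ((e₂ : ℝ) - x 0) * ((e₃ : ℝ) - x 0) *
        ((x 1 - (e₁ : ℝ)) * (x 1 - (e₂ : ℝ)) * ((e₃ : ℝ) - x 1))) := by positivity
    have hR : 0 < 4 / (1 + U ^ 2) * (U * Z *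
        (((e₂ : ℝ) - (e₁ : ℝ)) / (4 * (x 0 - (e₁ : ℝ)) * ((e₂ : ℝ) - x 0) * ((e₃ : ℝ) - x 1)) +
          ((e₂ : ℝ) - (e₁ : ℝ)) / (4 * (x 1 - (e₁ : ℝ)) * (x 1 - (e₂ : ℝ)) * ((e₃ : ℝ) - x 0)))) := by
      positivity
    refine (pow_left_inj₀ hL.le hR.le two_ne_zero).mp ?_
    rw [div_pow, Real.sq_sqrt (by positivity), mul_pow, mul_pow, mul_pow, hU2, hZ2]
    field_simp
    ring

end Summit.KontsevichZagierPeriods.UnfoldedStokes.LegendreCubicFormLine
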